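import Summits.AtomisticToContinuum.HydrodynamicLimit.Theorems.OneFlightGossipEngineClampedCurrentsDockHeartTools
import Summits.AtomisticToContinuum.HydrodynamicLimit.Theorems.JParityClosureParityInBandSmoothTest
import HarnessLib

/-!
# The heart of Yau's entropy ledger — quadratic growth of the frozen integrands (crux `ClampedCurrentsDock`, stmt-14680, line `IdeatorTwoSketch`)

Helper file (`--supports stmt-AtomisticToContinuum-14680`) for the registered stub `stub_oneWindowLedger`: continuity and
quadratic growth in the velocity, `|F(x,v)| ≤ C(1 + ‖v‖²)`, of the three streaming integrands fed to the entropy inequality —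
the low part `lo` of the fast kinetic currents (traceless stress + cut-off heat flux with a bounded radial profile), the momentum
rows and the energy row of the local EOS projection — for smooth frozen profiles on the compact torus.
prover-line-stmt-AtomisticToContinuum-14680-c2-0 (lead c2).
-/

noncomputable section

namespace Summit.AtomisticToContinuum.HydrodynamicLimit.Theorems.ClampedCurrentsDockHeart

open scoped BigOperators ENNReal Classical Interval
open MeasureTheory Filter Set Topology InformationTheory
open Literature.MathematicalPhysics.KineticTheory Literature.Analysis.FluidPDE Literature.Analysis.FunctionSpaces
open Summit.AtomisticToContinuum.HydrodynamicLimit.Theorems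

/-- **Growth of the low part of the fast currents.** For smooth `θ₀ > 0`, `u₀` and a continuous radial profile `G` bounded on
`s′ ≥ 0`, the functional `lo(x,v) = θ₀⁻¹Σ_{jk}(w_jw_k − δ_{jk}|w|²/3)∂_ku_j + (Σ_k ∂_kθ₀/(2θ₀²) w_k) G(x,|w|²)`, `w = v − u₀(x)`, is
continuous with `|lo(x,v)| ≤ C(1 + ‖v‖²)`. [folklore] -/
theorem exists_growth_lo {θ₀ : T3 → ℝ} {u₀ : T3 → V3} {Gs : T3 × ℝ → ℝ} {CG : ℝ}
    (hθ : Torus.IsSmooth θ₀) (hu : Torus.IsSmooth u₀) (hθ0 : ∀ x, 0 < θ₀ x) (hG : Continuous Gs)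
    (hGb : ∀ y : T3 × ℝ, 0 ≤ y.2 → |Gs y| ≤ CG) :
    ∃ C : ℝ, (Continuous fun y : T3 × V3 =>
        (θ₀ y.1)⁻¹ * ∑ j : Fin 3, ∑ k : Fin 3,
            ((y.2 - u₀ y.1) j * (y.2 - u₀ y.1) k - (if j = k then ‖y.2 - u₀ y.1‖ ^ 2 / 3 else 0)) *
              Torus.partialDeriv k (fun x => u₀ x j) y.1 +
          (∑ k : Fin 3, Torus.partialDeriv k θ₀ y.1 / (2 * (θ₀ y.1) ^ 2) * (y.2 - u₀ y.1) k) *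
            Gs (y.1, ‖y.2 - u₀ y.1‖ ^ 2)) ∧
      ∀ y : T3 × V3, |(θ₀ y.1)⁻¹ * ∑ j : Fin 3, ∑ k : Fin 3,
            ((y.2 - u₀ y.1) j * (y.2 - u₀ y.1) k - (if j = k then ‖y.2 - u₀ y.1‖ ^ 2 / 3 else 0)) *
              Torus.partialDeriv k (fun x => u₀ x j) y.1 +
          (∑ k : Fin 3, Torus.partialDeriv k θ₀ y.1 / (2 * (θ₀ y.1) ^ 2) * (y.2 - u₀ y.1) k) *
            Gs (y.1, ‖y.2 - u₀ y.1‖ ^ 2)| ≤ C * (1 + ‖y.2‖ ^ 2) := by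
  set Dθ : Fin 3 → T3 → ℝ := fun k => Torus.partialDeriv k θ₀ with hDθ
  set Du : Fin 3 → Fin 3 → T3 → ℝ := fun k j => Torus.partialDeriv k (fun x => u₀ x j) with hDu
  have hθc : Continuous θ₀ := hθ.continuous
  have huc : Continuous u₀ := hu.continuous
  have hDθc : ∀ k, Continuous (Dθ k) := fun k => (hθ.partialDeriv k).continuous
  have hDuc : ∀ k j, Continuous (Du k j) := fun k j => ((hu.apply j).partialDeriv k).continuous
  have hθne : ∀ y : T3 × V3, θ₀ y.1 ≠ 0 := fun y => (hθ0 _).ne'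
  -- constants by compactness
  obtain ⟨x₀, -, hx₀⟩ := isCompact_univ.exists_isMinOn Set.univ_nonempty hθc.continuousOn
  have hθm0 : 0 < θ₀ x₀ := hθ0 x₀
  have hθmle : ∀ x, θ₀ x₀ ≤ θ₀ x := fun x => hx₀ (Set.mem_univ x)
  obtain ⟨BU, hBU0, hBU⟩ := exists_abs_le_of_continuous_T3 (continuous_norm.comp huc)
  have hBU' : ∀ x, ‖u₀ x‖ ≤ BU := fun x => (le_abs_self _).trans (hBU x)
  obtain ⟨BDu, hBDu0, hBDu⟩ := exists_abs_le_of_continuous_T3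
    (continuous_finsetSum _ fun j _ => continuous_finsetSum _ fun k _ => continuous_abs.comp (hDuc k j) :
      Continuous fun x => ∑ j : Fin 3, ∑ k : Fin 3, |Du k j x|)
  obtain ⟨BDθ, hBDθ0, hBDθ⟩ := exists_abs_le_of_continuous_T3
    (continuous_finsetSum _ fun k _ => continuous_abs.comp (hDθc k) : Continuous fun x => ∑ k : Fin 3, |Dθ k x|)
  have hCG0 : 0 ≤ max CG 0 := le_max_right _ _
  refine ⟨2 * (0 + BDθ * max CG 0 / (2 * (θ₀ x₀) ^ 2) + 4 / 3 * BDu / θ₀ x₀) * (1 + BU) ^ 2, ?_, fun y => ?_⟩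
  · have h1 : Continuous fun y : T3 × V3 => (θ₀ y.1)⁻¹ := by fun_prop (disch := (intro y; exact hθne y))
    have h2 : Continuous fun y : T3 × V3 => ∑ j : Fin 3, ∑ k : Fin 3,
        ((y.2 - u₀ y.1) j * (y.2 - u₀ y.1) k - (if j = k then ‖y.2 - u₀ y.1‖ ^ 2 / 3 else 0)) * Du k j y.1 := by
      refine continuous_finsetSum _ fun j _ => continuous_finsetSum _ fun k _ => ?_
      by_cases h : j = k
      · simp only [if_pos h]; fun_prop
      · simp only [if_neg h]; fun_prop
    have h3 : Continuous fun y : T3 × V3 =>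
        (∑ k : Fin 3, Dθ k y.1 / (2 * (θ₀ y.1) ^ 2) * (y.2 - u₀ y.1) k) * Gs (y.1, ‖y.2 - u₀ y.1‖ ^ 2) := by
      fun_prop (disch := (intro y; exact mul_ne_zero two_ne_zero (pow_ne_zero _ (hθne y))))
    exact (h1.mul h2).add h3
  · have hθy := hθmle y.1
    have hθy0 : 0 < θ₀ y.1 := hθ0 y.1
    have hw2 : 0 ≤ ‖y.2 - u₀ y.1‖ ^ 2 := sq_nonneg _
    have h1 := abs_stressForm_le (y.2 - u₀ y.1) (fun k j => Du k j y.1)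
    have h2 := abs_linForm_le (y.2 - u₀ y.1) (fun k => Dθ k y.1 / (2 * (θ₀ y.1) ^ 2))
    have h3 : ∑ k : Fin 3, |Dθ k y.1 / (2 * (θ₀ y.1) ^ 2)| ≤ BDθ / (2 * (θ₀ x₀) ^ 2) := by
      have e : ∑ k : Fin 3, |Dθ k y.1 / (2 * (θ₀ y.1) ^ 2)| = (∑ k : Fin 3, |Dθ k y.1|) / (2 * (θ₀ y.1) ^ 2) := by
        rw [Finset.sum_div]
        refine Finset.sum_congr rfl fun k _ => ?_
        rw [abs_div, abs_of_pos (mul_pos two_pos (pow_pos hθy0 2))]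
      rw [e]
      have : (∑ k : Fin 3, |Dθ k y.1|) ≤ BDθ := (le_abs_self _).trans (hBDθ y.1)
      calc (∑ k : Fin 3, |Dθ k y.1|) / (2 * (θ₀ y.1) ^ 2) ≤ BDθ / (2 * (θ₀ y.1) ^ 2) := by gcongr
        _ ≤ BDθ / (2 * (θ₀ x₀) ^ 2) := by gcongr
    have h4 : (∑ j : Fin 3, ∑ k : Fin 3, |Du k j y.1|) ≤ BDu := (le_abs_self _).trans (hBDu y.1)
    have hGy : |Gs (y.1, ‖y.2 - u₀ y.1‖ ^ 2)| ≤ max CG 0 := (hGb _ hw2).trans (le_max_left _ _)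
    have hq : |(θ₀ y.1)⁻¹ * ∑ j : Fin 3, ∑ k : Fin 3,
        ((y.2 - u₀ y.1) j * (y.2 - u₀ y.1) k - (if j = k then ‖y.2 - u₀ y.1‖ ^ 2 / 3 else 0)) * Du k j y.1| ≤
        4 / 3 * BDu / θ₀ x₀ * ‖y.2 - u₀ y.1‖ ^ 2 := by
      rw [abs_mul, abs_of_pos (inv_pos.2 hθy0)]
      calc (θ₀ y.1)⁻¹ * |∑ j : Fin 3, ∑ k : Fin 3,
            ((y.2 - u₀ y.1) j * (y.2 - u₀ y.1) k - (if j = k then ‖y.2 - u₀ y.1‖ ^ 2 / 3 else 0)) * Du k j y.1|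
          ≤ (θ₀ x₀)⁻¹ * (4 / 3 * ‖y.2 - u₀ y.1‖ ^ 2 * BDu) := by
            refine mul_le_mul (inv_anti₀ hθm0 hθy) (h1.trans ?_) (abs_nonneg _) (by positivity)
            gcongr
        _ = 4 / 3 * BDu / θ₀ x₀ * ‖y.2 - u₀ y.1‖ ^ 2 := by ring
    have hfl : |(∑ k : Fin 3, Dθ k y.1 / (2 * (θ₀ y.1) ^ 2) * (y.2 - u₀ y.1) k) * Gs (y.1, ‖y.2 - u₀ y.1‖ ^ 2)| ≤
        BDθ * max CG 0 / (2 * (θ₀ x₀) ^ 2) * ‖y.2 - u₀ y.1‖ := by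
      rw [abs_mul]
      calc |∑ k : Fin 3, Dθ k y.1 / (2 * (θ₀ y.1) ^ 2) * (y.2 - u₀ y.1) k| * |Gs (y.1, ‖y.2 - u₀ y.1‖ ^ 2)|
          ≤ (BDθ / (2 * (θ₀ x₀) ^ 2) * ‖y.2 - u₀ y.1‖) * max CG 0 :=
            mul_le_mul (h2.trans (by gcongr)) hGy (abs_nonneg _) (by positivity)
        _ = BDθ * max CG 0 / (2 * (θ₀ x₀) ^ 2) * ‖y.2 - u₀ y.1‖ := by ring
    have hg := growth_le (a := 0) (b := BDθ * max CG 0 / (2 * (θ₀ x₀) ^ 2)) (c := 4 / 3 * BDu / θ₀ x₀) le_rfl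
      (by positivity) (by positivity) hBU0 (u₀ y.1) y.2 (hBU' y.1)
    calc _ ≤ |(θ₀ y.1)⁻¹ * ∑ j : Fin 3, ∑ k : Fin 3,
          ((y.2 - u₀ y.1) j * (y.2 - u₀ y.1) k - (if j = k then ‖y.2 - u₀ y.1‖ ^ 2 / 3 else 0)) * Du k j y.1| +
          |(∑ k : Fin 3, Dθ k y.1 / (2 * (θ₀ y.1) ^ 2) * (y.2 - u₀ y.1) k) * Gs (y.1, ‖y.2 - u₀ y.1‖ ^ 2)| :=
          abs_add_le _ _
      _ ≤ 0 + BDθ * max CG 0 / (2 * (θ₀ x₀) ^ 2) * ‖y.2 - u₀ y.1‖ + 4 / 3 * BDu / θ₀ x₀ * ‖y.2 - u₀ y.1‖ ^ 2 := by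
          linarith [hq, hfl]
      _ ≤ _ := hg

/-- **Growth of a momentum row of the EOS projection**: `F_k(x,v) = ∂_kφ_k(x)·(θ₀ρ₀σ³Z′ + (Z−1)|v − u₀|²/3)` is continuous with
`|F_k| ≤ C(1 + ‖v‖²)` for smooth `θ₀ > 0`, `u₀` and continuous `ρ₀`, `Z`, `Z′`. [folklore] -/
theorem exists_growth_rowk {θ₀ ρ₀ Zf Z'f : T3 → ℝ} {u₀ : T3 → V3} (σ : ℝ) (k : Fin 3)
    (hθ : Torus.IsSmooth θ₀) (hu : Torus.IsSmooth u₀) (hθ0 : ∀ x, 0 < θ₀ x) (hρ : Continuous ρ₀)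
    (hZ : Continuous Zf) (hZ' : Continuous Z'f) :
    ∃ C : ℝ, (Continuous fun y : T3 × V3 => Torus.partialDeriv k (fun x => u₀ x k / θ₀ x) y.1 *
        (θ₀ y.1 * (ρ₀ y.1 * σ ^ 3) * Z'f y.1 + (1 / 3) * (Zf y.1 - 1) * ‖y.2 - u₀ y.1‖ ^ 2)) ∧
      ∀ y : T3 × V3, |Torus.partialDeriv k (fun x => u₀ x k / θ₀ x) y.1 *
        (θ₀ y.1 * (ρ₀ y.1 * σ ^ 3) * Z'f y.1 + (1 / 3) * (Zf y.1 - 1) * ‖y.2 - u₀ y.1‖ ^ 2)| ≤ C * (1 + ‖y.2‖ ^ 2) := by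
  have hφ : Torus.IsSmooth (fun x => u₀ x k / θ₀ x) := (hu.apply k).div hθ fun _ => (hθ0 _).ne'
  set Dm : T3 → ℝ := Torus.partialDeriv k (fun x => u₀ x k / θ₀ x) with hDm
  have hDmc : Continuous Dm := (hφ.partialDeriv k).continuous
  have hθc : Continuous θ₀ := hθ.continuous
  have huc : Continuous u₀ := hu.continuous
  obtain ⟨BU, hBU0, hBU⟩ := exists_abs_le_of_continuous_T3 (continuous_norm.comp huc)
  have hBU' : ∀ x, ‖u₀ x‖ ≤ BU := fun x => (le_abs_self _).trans (hBU x)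
  obtain ⟨Bα, hBα0, hBα⟩ := exists_abs_le_of_continuous_T3 (by fun_prop : Continuous fun x => θ₀ x * (ρ₀ x * σ ^ 3) * Z'f x)
  obtain ⟨BZ, hBZ0, hBZ⟩ := exists_abs_le_of_continuous_T3 (by fun_prop : Continuous fun x => Zf x - 1)
  obtain ⟨BDm, hBDm0, hBDm⟩ := exists_abs_le_of_continuous_T3 hDmc
  refine ⟨2 * (BDm * Bα + 0 + BDm * BZ / 3) * (1 + BU) ^ 2, ?_, fun y => ?_⟩
  · show Continuous fun y : T3 × V3 => Dm y.1 *
        (θ₀ y.1 * (ρ₀ y.1 * σ ^ 3) * Z'f y.1 + (1 / 3) * (Zf y.1 - 1) * ‖y.2 - u₀ y.1‖ ^ 2)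
    fun_prop
  · have hD : |Dm y.1| ≤ BDm := hBDm y.1
    have hin : |θ₀ y.1 * (ρ₀ y.1 * σ ^ 3) * Z'f y.1 + 1 / 3 * (Zf y.1 - 1) * ‖y.2 - u₀ y.1‖ ^ 2| ≤
        Bα + BZ / 3 * ‖y.2 - u₀ y.1‖ ^ 2 := by
      refine (abs_add_le _ _).trans (add_le_add (hBα y.1) ?_)
      rw [abs_mul, abs_mul, abs_of_pos (by norm_num : (0 : ℝ) < 1 / 3), abs_of_nonneg (sq_nonneg ‖y.2 - u₀ y.1‖)]
      nlinarith [sq_nonneg ‖y.2 - u₀ y.1‖, abs_nonneg (Zf y.1 - 1), hBZ y.1]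
    have h1 : |Dm y.1 * (θ₀ y.1 * (ρ₀ y.1 * σ ^ 3) * Z'f y.1 + 1 / 3 * (Zf y.1 - 1) * ‖y.2 - u₀ y.1‖ ^ 2)| ≤
        BDm * Bα + 0 * ‖y.2 - u₀ y.1‖ + BDm * BZ / 3 * ‖y.2 - u₀ y.1‖ ^ 2 := by
      rw [abs_mul]
      nlinarith [mul_le_mul hD hin (abs_nonneg _) hBDm0, abs_nonneg (Dm y.1)]
    exact h1.trans (growth_le (by positivity) le_rfl (by positivity) hBU0 (u₀ y.1) y.2 (hBU' y.1))

/-- **Growth of the energy row of the EOS projection** (test function `φ_e = −θ₀⁻¹`):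
`F_e(x,v) = (Σ_l u₀_l∂_lφ_e)(θ₀ρ₀σ³Z′ + (Z−1)|v − u₀|²/3) + θ₀(Z−1)Σ_l ∂_lφ_e (v − u₀)_l` is continuous with `|F_e| ≤ C(1 + ‖v‖²)`.
[folklore] -/
theorem exists_growth_rowe {θ₀ ρ₀ Zf Z'f : T3 → ℝ} {u₀ : T3 → V3} (σ : ℝ)
    (hθ : Torus.IsSmooth θ₀) (hu : Torus.IsSmooth u₀) (hθ0 : ∀ x, 0 < θ₀ x) (hρ : Continuous ρ₀)
    (hZ : Continuous Zf) (hZ' : Continuous Z'f) :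
    ∃ C : ℝ, (Continuous fun y : T3 × V3 =>
        (∑ l : Fin 3, u₀ y.1 l * Torus.partialDeriv l (fun x => -(θ₀ x)⁻¹) y.1) *
            (θ₀ y.1 * (ρ₀ y.1 * σ ^ 3) * Z'f y.1 + (1 / 3) * (Zf y.1 - 1) * ‖y.2 - u₀ y.1‖ ^ 2) +
          θ₀ y.1 * (Zf y.1 - 1) * (∑ l : Fin 3, Torus.partialDeriv l (fun x => -(θ₀ x)⁻¹) y.1 * (y.2 - u₀ y.1) l)) ∧
      ∀ y : T3 × V3, |(∑ l : Fin 3, u₀ y.1 l * Torus.partialDeriv l (fun x => -(θ₀ x)⁻¹) y.1) *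
            (θ₀ y.1 * (ρ₀ y.1 * σ ^ 3) * Z'f y.1 + (1 / 3) * (Zf y.1 - 1) * ‖y.2 - u₀ y.1‖ ^ 2) +
          θ₀ y.1 * (Zf y.1 - 1) * (∑ l : Fin 3, Torus.partialDeriv l (fun x => -(θ₀ x)⁻¹) y.1 * (y.2 - u₀ y.1) l)| ≤
        C * (1 + ‖y.2‖ ^ 2) := by
  have hφ : Torus.IsSmooth (fun x => -(θ₀ x)⁻¹) := (hθ.inv fun _ => (hθ0 _).ne').neg
  set De : Fin 3 → T3 → ℝ := fun l => Torus.partialDeriv l (fun x => -(θ₀ x)⁻¹) with hDe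
  have hDec : ∀ l, Continuous (De l) := fun l => (hφ.partialDeriv l).continuous
  have hθc : Continuous θ₀ := hθ.continuous
  have huc : Continuous u₀ := hu.continuous
  obtain ⟨BU, hBU0, hBU⟩ := exists_abs_le_of_continuous_T3 (continuous_norm.comp huc)
  have hBU' : ∀ x, ‖u₀ x‖ ≤ BU := fun x => (le_abs_self _).trans (hBU x)
  obtain ⟨Bα, hBα0, hBα⟩ := exists_abs_le_of_continuous_T3 (by fun_prop : Continuous fun x => θ₀ x * (ρ₀ x * σ ^ 3) * Z'f x)
  obtain ⟨BZ, hBZ0, hBZ⟩ := exists_abs_le_of_continuous_T3 (by fun_prop : Continuous fun x => Zf x - 1)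
  obtain ⟨BDe, hBDe0, hBDe⟩ := exists_abs_le_of_continuous_T3
    (continuous_finsetSum _ fun l _ => continuous_abs.comp (hDec l) : Continuous fun x => ∑ l : Fin 3, |De l x|)
  obtain ⟨Bθ, hBθ0, hBθ⟩ := exists_abs_le_of_continuous_T3 hθc
  refine ⟨2 * (BU * BDe * Bα + Bθ * BZ * BDe + BU * BDe * BZ / 3) * (1 + BU) ^ 2, ?_, fun y => ?_⟩
  · show Continuous fun y : T3 × V3 => (∑ l : Fin 3, u₀ y.1 l * De l y.1) *
        (θ₀ y.1 * (ρ₀ y.1 * σ ^ 3) * Z'f y.1 + (1 / 3) * (Zf y.1 - 1) * ‖y.2 - u₀ y.1‖ ^ 2) +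
        θ₀ y.1 * (Zf y.1 - 1) * (∑ l : Fin 3, De l y.1 * (y.2 - u₀ y.1) l)
    fun_prop
  · have hDe' : (∑ l : Fin 3, |De l y.1|) ≤ BDe := (le_abs_self _).trans (hBDe y.1)
    have hc1 : |∑ l : Fin 3, u₀ y.1 l * De l y.1| ≤ BU * BDe := by
      have e : ∑ l : Fin 3, u₀ y.1 l * De l y.1 = ∑ l : Fin 3, De l y.1 * u₀ y.1 l :=
        Finset.sum_congr rfl fun l _ => mul_comm _ _
      rw [e]
      calc |∑ l : Fin 3, De l y.1 * u₀ y.1 l| ≤ (∑ l : Fin 3, |De l y.1|) * ‖u₀ y.1‖ := abs_linForm_le _ _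
        _ ≤ BDe * BU := mul_le_mul hDe' (hBU' y.1) (norm_nonneg _) hBDe0
        _ = BU * BDe := mul_comm _ _
    have hc2 : |∑ l : Fin 3, De l y.1 * (y.2 - u₀ y.1) l| ≤ BDe * ‖y.2 - u₀ y.1‖ :=
      (abs_linForm_le (y.2 - u₀ y.1) (fun l => De l y.1)).trans (by gcongr)
    have hin : |θ₀ y.1 * (ρ₀ y.1 * σ ^ 3) * Z'f y.1 + 1 / 3 * (Zf y.1 - 1) * ‖y.2 - u₀ y.1‖ ^ 2| ≤
        Bα + BZ / 3 * ‖y.2 - u₀ y.1‖ ^ 2 := by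
      refine (abs_add_le _ _).trans (add_le_add (hBα y.1) ?_)
      rw [abs_mul, abs_mul, abs_of_pos (by norm_num : (0 : ℝ) < 1 / 3), abs_of_nonneg (sq_nonneg ‖y.2 - u₀ y.1‖)]
      nlinarith [sq_nonneg ‖y.2 - u₀ y.1‖, abs_nonneg (Zf y.1 - 1), hBZ y.1]
    have h1 : |(∑ l : Fin 3, u₀ y.1 l * De l y.1) *
          (θ₀ y.1 * (ρ₀ y.1 * σ ^ 3) * Z'f y.1 + 1 / 3 * (Zf y.1 - 1) * ‖y.2 - u₀ y.1‖ ^ 2) +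
          θ₀ y.1 * (Zf y.1 - 1) * (∑ l : Fin 3, De l y.1 * (y.2 - u₀ y.1) l)| ≤
        BU * BDe * Bα + Bθ * BZ * BDe * ‖y.2 - u₀ y.1‖ + BU * BDe * BZ / 3 * ‖y.2 - u₀ y.1‖ ^ 2 := by
      refine (abs_add_le _ _).trans ?_
      rw [abs_mul, abs_mul, abs_mul]
      have t1 := mul_le_mul hc1 hin (abs_nonneg _) (by positivity)
      have t2 : |θ₀ y.1| * |Zf y.1 - 1| * |∑ l : Fin 3, De l y.1 * (y.2 - u₀ y.1) l| ≤ Bθ * BZ * (BDe * ‖y.2 - u₀ y.1‖) :=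
        mul_le_mul (mul_le_mul (hBθ y.1) (hBZ y.1) (abs_nonneg _) hBθ0) hc2 (abs_nonneg _) (by positivity)
      nlinarith [t1, t2]
    exact h1.trans (growth_le (by positivity) (by positivity) (by positivity) hBU0 (u₀ y.1) y.2 (hBU' y.1))

end Summit.AtomisticToContinuum.HydrodynamicLimit.Theorems.ClampedCurrentsDockHeart

end
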